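import Summits.Ventures.AbcSig.Rows.StatementsC1b
import Summits.Ventures.AbcSig.Rows.XnYn59Z2EvenXCell

/-!
# Venture AbcSig — p1's named statement `Rows.C1C59EvenSigned` ASSEMBLED from the landed cell theorems (GENERATED by p-lean g5 `gen5/conj.py`)

HONEST FRAMING. COMPUTATION cell `pub-abcsig`; CONDITIONAL theorem; no claim on ABC or any summit. This file only composes:
p1's `Rows.C1C59EvenSigned` (:= `Rows.C1CellEven 59 11 ∅`; row of record census/rows/C1/C1-C59-even.md) is definitionally the conclusion of the cell theorem used; this file gives it the ledger's name.
Hypotheses = the UNION of the cells' hypotheses verbatim (a binder name used by two cells with different statements carries a suffix `_2`, `_3`, …):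
`BS04Package` (CITED), `EisPackage` / `EisChiPackage` where a cell discharges a module certificate in the kernel (CITED recipes), `DataComplete` at the
levels [6962] and `RefinesCPSymAll` at the norm-form levels + the `Refines…` of kernel module certificates (COMPUTED), and 3 per-orbit CITED exclusions `hX_…`.
Where the named statement uses p1's UNREDUCED predicate `Rows.C2aCell` (all `m ≥ 1` with `n ∤ m`), the reduced cell (`Rows.C2aCellRed`, RULING H1) is
transported by the n-th-power absorption bridge `C2aCell_of_red` of `Rows/BridgeRed.lean` (bounded 2-exponent classes only).
Cells used: `C1CellEven_59_of` (XnYn59Z2EvenXCell.lean).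
-/

namespace Summit.Ventures.AbcSig

/-- **`Rows.C1C59EvenSigned`** from the cell theorems (hypotheses = union of theirs). -/
theorem C1C59EvenSigned_of (M : NewformModel) (hP : M.BS04Package)
    (hD6962 : M.DataComplete 6962 level6962Orbits) (hCP6962 : M.RefinesCPSymAll 6962 level6962CP)
    (hX_orbit_6962_6 : ∀ n : ℕ, n ∈ ([11] : List ℕ) → M.Excludes 6962 orbit_6962_6 (fun S => S.A = 1 ∧ S.B = 1 ∧ S.C = 59 ∧ S.n = n ∧ 2 ∣ S.a * S.b))
    (hX_orbit_6962_37 : ∀ n : ℕ, n ∈ ([29] : List ℕ) → M.Excludes 6962 orbit_6962_37 (fun S => S.A = 1 ∧ S.B = 1 ∧ S.C = 59 ∧ S.n = n ∧ 2 ∣ S.a * S.b))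
    (hX_orbit_6962_38 : ∀ n : ℕ, n ∈ ([29] : List ℕ) → M.Excludes 6962 orbit_6962_38 (fun S => S.A = 1 ∧ S.B = 1 ∧ S.C = 59 ∧ S.n = n ∧ 2 ∣ S.a * S.b)) :
    Rows.C1C59EvenSigned :=
  (C1CellEven_59_of M hP hD6962 hCP6962 hX_orbit_6962_6 hX_orbit_6962_37 hX_orbit_6962_38)

end Summit.Ventures.AbcSig
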